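import Literature.AlgebraicGeometry.HodgeTheory.HypersurfaceSectionLefschetz
import Literature.AlgebraicGeometry.HodgeTheory.GlobalInvariantCyclesProofs
import Literature.AlgebraicGeometry.Motives.LinearSectionNet
import Literature.AlgebraicGeometry.Motives.ProjectiveSpaceFieldPointsBijective
import Literature.AlgebraicGeometry.Motives.HypersurfaceFieldPoints
import Literature.AlgebraicGeometry.Motives.AlgebraicEquivalenceFibreDimension
import Literature.AlgebraicGeometry.Motives.JacobianAlbanese
import HarnessLib

/-!
# The fibres of a pencil of hyperplane sections inside `X`, and weak Lefschetz for the smooth ones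

Topic `Literature/AlgebraicGeometry/HodgeTheory` (theorems only; no definitions, no named facts). For a closed immersion `ι : X ⟶ ℙᴺ` over
`ℂ` and two linear forms `a₀, a₁`, the tree's total space of the pencil
`X̃ = {(x, b) ∈ X × ℙ¹ | a₀(x) b₁ = a₁(x) b₀}` (`Motives/LinearSectionNet`: `total ι a` with
`emb : X̃ ⟶ X × ℙ¹`, `blowDown = σ = pr₁`, `proj = π = pr₂`; Hartshorne II Example 7.17.3, Voisin II
§2.1.1) has, over a complex point `t = [w₀ : w₁]`, the fibre `π⁻¹(t) = fiberOver (proj ι a) t`, and: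

* `fiberι_emb_eq_sliceAt` — `π⁻¹(t) ⟶ X̃ ⟶ X × ℙ¹` is `u_t ≫ s_t` for the composite
  `u_t : π⁻¹(t) ⟶ X̃ ⟶ X` and the slice `s_t : X ≅ X × {t}`;
* `isClosedImmersion_fiberι_blowDown_left` — `u_t` is a closed immersion;
* `range_map_fiberι_blowDown` — **on complex points the image of `u_t` is the hyperplane section
  `X ∩ V₊(w₁ a₀ − w₀ a₁)`** (the incidence equation read on `ℂ`-points through
  `Incidence.pt_lift_mem_range_emb_iff`; "each hypersurface `X_t` can be naturally identified with
  the fibre `π⁻¹(t) ⊂ X̃`", Voisin II §2.3.1, here only on points);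
* `injective_complexBettiMap_fiberι_blowDown`, `bijective_complexBettiMap_fiberι_blowDown_of_lt` —
  **weak Lefschetz for the smooth members through the blow-down**: if `X` is smooth projective of
  dimension `r + 1` and `π⁻¹(t)` is smooth projective, `u_t^* : Hᵏ(X(ℂ); ℂ) → Hᵏ(π⁻¹(t)(ℂ); ℂ)` is
  injective for `k ≤ r` and bijective for `k < r` — the tree's RANGE-based Lefschetz hyperplane
  theorem (Andreotti–Frankel for the complement of the hyperplane section,
  `HypersurfaceSectionComplement.isZero_singularHomology_compl_range_hypersurfaceSectionι`, and the
  duality steps `injective/surjective_complexBettiMap_of_isZero_singularHomology_compl_range`,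
  Voisin II Thm. 1.22–1.23) applied to `u_t`, whose range is that of the hyperplane section; no
  scheme-theoretic identification of `π⁻¹(t)` with `X ∩ V₊(ℓ)` is used.

Consumers: the discharge of `exists_fiberNet_pencil_weakLefschetz`
(`HodgeTheory/LefschetzPencilHyperplaneSectionsProofs`) and the pencil descent for algebraic classes
below the middle dimension (`HodgeTheory/PencilSpreadDescent`).

## References

* [VoisinHodgeII2003] C. Voisin, Hodge Theory and Complex Algebraic Geometry II (2003), §2.1.1,
  §2.3.1, §1.2.2 Thm. 1.22–1.23.
* [Hartshorne1977] R. Hartshorne, Algebraic Geometry (1977), II Example 7.17.3.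
-/

noncomputable section

open CategoryTheory CategoryTheory.Limits AlgebraicGeometry MonoidalCategory CartesianMonoidalCategory
  MvPolynomial
open Literature.AlgebraicGeometry.Motives
open Literature.AlgebraicGeometry.Motives.LinearSectionNet

universe u

namespace Literature.AlgebraicGeometry.HodgeTheory

section HodgeTheory


/-! ### Points: morphisms to `Spec k`, slices, fibres -/

section Points

variable {k : Type u} [Field k]

variable {N m : ℕ} {X : SchemeOver k} (ι : X ⟶ projectiveSpace N k) (a : Fin (m + 1) → Fin (N + 1) → k)
  (t : AlgPoints (projectiveSpace m k) k)

/-- **The fibre `π⁻¹(t) ⟶ X̃ ⟶ X × ℙᵐ` lies over the slice `X × {t}`**: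
`fiberι ≫ emb = (fiberι ≫ σ) ≫ s_t`. [folklore] -/
theorem fiberι_emb_eq_sliceAt :
    fiberι (proj ι a) t ≫ emb ι a = (fiberι (proj ι a) t ≫ blowDown ι a) ≫ sliceAt X t := by
  apply CartesianMonoidalCategory.hom_ext
  · rw [Category.assoc, emb_fst, Category.assoc, sliceAt_fst, Category.comp_id]
  · rw [Category.assoc, emb_snd, fiberι_comp, Category.assoc, sliceAt_snd, ← Category.assoc,
      eq_toSpecOver (fiberOverToSpec (proj ι a) t),
      eq_toSpecOver ((fiberι (proj ι a) t ≫ blowDown ι a) ≫ toSpecOver X)]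

/-- The fibre inclusion `π⁻¹(t) ⟶ X̃` is a closed immersion (base change of the rational point
`t : Spec k ⟶ ℙᵐ`, a closed immersion of the separated `ℙᵐ`). [folklore] -/
theorem isClosedImmersion_fiberι_proj_left : IsClosedImmersion (fiberι (proj ι a) t).left := by
  haveI := CurveNet.isSeparated_projectiveSpace_hom m k
  haveI : IsClosedImmersion t.left := CurveNet.isClosedImmersion_left_of_isSeparated t
  rw [fiberι_left]
  exact MorphismProperty.pullback_fst (P := @IsClosedImmersion) _ _ inferInstance

/-- **`u_t : π⁻¹(t) ⟶ X̃ ⟶ X` is a closed immersion** (`u_t ≫ s_t = fiberι ≫ emb` is one, and the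
slice `s_t` is separated). [folklore] -/
theorem isClosedImmersion_fiberι_blowDown_left :
    IsClosedImmersion (fiberι (proj ι a) t ≫ blowDown ι a).left := by
  haveI := isClosedImmersion_fiberι_proj_left ι a t
  have h1 : IsClosedImmersion (fiberι (proj ι a) t ≫ emb ι a).left := by
    rw [Over.comp_left]
    infer_instance
  rw [fiberι_emb_eq_sliceAt, Over.comp_left] at h1
  haveI : LocallyOfFiniteType (projectiveSpace m k).hom :=
    haveI : IsProper (projectiveSpace m k).hom := isProper_projectiveSpace m k
    inferInstance
  haveI : IsClosedImmersion (sliceAt X t).left := isClosedImmersion_sliceAt_left t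
  exact IsClosedImmersion.of_comp _ (sliceAt X t).left

/-- A point of `Y × T` is the pair of its projections. [folklore] -/
theorem eq_lift_map_fst_map_snd {L : Type u} [Field L] [Algebra k L] {Y T : SchemeOver k}
    (Q : AlgPoints (Y ⊗ T) L) :
    Q = CartesianMonoidalCategory.lift (AlgPoints.map (fst Y T) Q) (AlgPoints.map (snd Y T) Q) :=
  (AlgPoints.prodEquiv.symm_apply_apply Q).symm

end Points

/-! ### The complex points of the fibres of a pencil are the hyperplane sections -/

section Pencil

variable {N : ℕ} {X : SchemeOver ℂ} (ι : X ⟶ projectiveSpace N ℂ) [IsClosedImmersion ι.left]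
  (a : Fin (1 + 1) → Fin (N + 1) → ℂ)

/-- The linear form `ℓ_{w₁ a₀ − w₀ a₁}` of the member `H_t` of the pencil over `t = [w₀ : w₁]`
(coefficient vector `c ↦ w₁ a₀c − w₀ a₁c`) is homogeneous of degree `1`. [folklore] -/
theorem isHomogeneous_linForm_member (w : Fin (1 + 1) → ℂ) :
    (Resolution.LinSec.linForm (fun c ↦ w 1 * a 0 c - w 0 * a 1 c)).IsHomogeneous 1 :=
  (MvPolynomial.mem_homogeneousSubmodule 1 _).1 (Resolution.LinSec.linForm_mem _)

/-- Evaluation of the member form: `ℓ_{w₁ a₀ − w₀ a₁}(z) = w₁ a₀(z) − w₀ a₁(z)`. [folklore] -/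
theorem aeval_linForm_member (w : Fin (1 + 1) → ℂ) (z : Fin (N + 1) → ℂ) :
    aeval z (Resolution.LinSec.linForm (fun c ↦ w 1 * a 0 c - w 0 * a 1 c)) =
      w 1 * linEval (a 0) z - w 0 * linEval (a 1) z := by
  rw [aeval_linForm]
  simp only [linEval, Algebra.algebraMap_self, RingHom.id_apply, Finset.mul_sum]
  rw [← Finset.sum_sub_distrib]
  refine Finset.sum_congr rfl fun c _ ↦ ?_
  ring

/-- **The incidence equation on complex points**: for `x ∈ X(ℂ)` with `ι(x) = [z]` and
`t = [w] ∈ ℙ¹(ℂ)`, the point `(x, t)` of `X × ℙ¹` lies on `X̃` iff `a₀(z) w₁ = a₁(z) w₀`.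
[cite: Hartshorne1977, II Example 7.17.3] -/
theorem pt_lift_mem_locus_iff (x : ComplexPoints X) (z : Fin (N + 1) → ℂ) (hz : z ≠ 0)
    (hx : AlgPoints.map ι x = ProjectiveSpace.pointOfVec ℂ z hz)
    (w : Fin (1 + 1) → ℂ) (hw : w ≠ 0) :
    AlgPoints.pt (CartesianMonoidalCategory.lift x (ProjectiveSpace.pointOfVec ℂ w hw)) ∈
        (locus ι a : Set (X ⊗ projectiveSpace 1 ℂ).left) ↔
      linEval (a 0) z * w 1 = linEval (a 1) z * w 0 := by
  haveI : IsClosedImmersion (𝟙 (projectiveSpace 1 ℂ) : projectiveSpace 1 ℂ ⟶ _).left := by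
    rw [Over.id_left]; infer_instance
  rw [coe_locus_eq_range, Incidence.pt_lift_mem_range_emb_iff ι (𝟙 (projectiveSpace 1 ℂ))
    (forms_isHomogeneous a) x z hz hx (ProjectiveSpace.pointOfVec ℂ w hw) w hw
    (by rw [AlgPoints.map_id]; rfl)]
  constructor
  · intro h
    have h01 := h _ ⟨((0 : Fin (1 + 1)), (1 : Fin (1 + 1))), rfl⟩
    rw [aeval_segreVec_incidenceForm] at h01
    exact sub_eq_zero.1 h01
  · rintro h _ ⟨⟨i, j⟩, rfl⟩
    rw [aeval_segreVec_incidenceForm]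
    fin_cases i <;> fin_cases j
    · exact sub_self _
    · exact sub_eq_zero.2 h
    · exact sub_eq_zero.2 h.symm
    · exact sub_self _

/-- **The complex points of the fibre of the pencil over `t = [w]`, inside `X`, are those of the
hyperplane section `X ∩ V₊(w₁ a₀ − w₀ a₁)`**: the closed immersions `u_t : π⁻¹(t) ⟶ X̃ ⟶ X` and
`X ∩ V₊(ℓ) ⟶ X` have the same image on `ℂ`-points ("each hypersurface `X_t` can be naturally
identified with the fibre `π⁻¹(t) ⊂ X̃`", read on points). [cite: VoisinHodgeII2003, §2.1.1 and §2.3.1] -/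
theorem range_map_fiberι_blowDown (w : Fin (1 + 1) → ℂ) (hw : w ≠ 0) :
    Set.range (AlgPoints.map (L := ℂ)
        (fiberι (proj ι a) (ProjectiveSpace.pointOfVec ℂ w hw) ≫ blowDown ι a)) =
      Set.range (AlgPoints.map (L := ℂ)
        ((⟨N, ι, inferInstance⟩ : ProjectiveEmbedding X).hypersurfaceSectionι
          (Resolution.LinSec.linForm (fun c ↦ w 1 * a 0 c - w 0 * a 1 c)) (isHomogeneous_linForm_member a w))) := by
  set t : ComplexPoints (projectiveSpace 1 ℂ) := ProjectiveSpace.pointOfVec ℂ w hw with htdef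
  set e : ProjectiveEmbedding X := ⟨N, ι, inferInstance⟩ with hedef
  ext x
  obtain ⟨z, hz, hxz⟩ := ProjectiveSpace.exists_eq_pointOfVec (AlgPoints.map ι x)
  -- the right-hand side: `ℓ(z) = 0`
  have hR : x ∈ Set.range (AlgPoints.map (L := ℂ)
      (e.hypersurfaceSectionι (Resolution.LinSec.linForm (fun c ↦ w 1 * a 0 c - w 0 * a 1 c))
        (isHomogeneous_linForm_member a w))) ↔ linEval (a 0) z * w 1 = linEval (a 1) z * w 0 := by
    -- `x.pt ∈ ι⁻¹ V₊(ℓ)` iff `ℓ(z) = 0`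
    have key : x.pt ∈ Set.range (e.hypersurfaceSectionι
        (Resolution.LinSec.linForm (fun c ↦ w 1 * a 0 c - w 0 * a 1 c))
        (isHomogeneous_linForm_member a w)).left ↔ linEval (a 0) z * w 1 = linEval (a 1) z * w 0 := by
      rw [range_hypersurfaceSectionι e _ _ one_pos, Set.mem_preimage]
      have h1 : e.toProj x.pt = AlgPoints.pt (ProjectiveSpace.pointOfVec ℂ z hz) := by
        rw [← hxz]
        rfl
      rw [h1]
      refine (ProjectiveSpace.pt_pointOfVec_mem_zeroLocus_iff z hz one_pos
        (Resolution.LinSec.linForm_mem _)).trans ?_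
      rw [aeval_linForm_member, sub_eq_zero, mul_comm (w 1), mul_comm (w 0)]
    constructor
    · rintro ⟨y, rfl⟩
      exact key.1 (AlgPoints.pt_map_mem_range _ y)
    · intro h
      exact ⟨AlgPoints.liftClosed _ x (key.2 h), AlgPoints.map_liftClosed _ _ (key.2 h)⟩
  rw [hR]
  -- the left-hand side: `(x, t) ∈ X̃`
  rw [← pt_lift_mem_locus_iff ι a x z hz hxz w hw, ← range_emb]
  constructor
  · rintro ⟨y, rfl⟩
    have hπ : AlgPoints.map (proj ι a) (AlgPoints.map (fiberι (proj ι a) t) y) = t := by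
      have := AlgPoints.range_map_fiberι (proj ι a) t
      rw [Set.ext_iff] at this
      exact (this _).1 ⟨y, rfl⟩
    have hQ : AlgPoints.map (emb ι a) (AlgPoints.map (fiberι (proj ι a) t) y) =
        CartesianMonoidalCategory.lift
          (AlgPoints.map (fiberι (proj ι a) t ≫ blowDown ι a) y) t := by
      have e1 : AlgPoints.map (fst X (projectiveSpace 1 ℂ))
          (AlgPoints.map (emb ι a) (AlgPoints.map (fiberι (proj ι a) t) y)) =
          AlgPoints.map (fiberι (proj ι a) t ≫ blowDown ι a) y := by
        rw [← AlgPoints.map_comp_apply, ← AlgPoints.map_comp_apply]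
        rfl
      have e2 : AlgPoints.map (snd X (projectiveSpace 1 ℂ))
          (AlgPoints.map (emb ι a) (AlgPoints.map (fiberι (proj ι a) t) y)) = t := by
        rw [← AlgPoints.map_comp_apply, emb_snd, hπ]
      rw [eq_lift_map_fst_map_snd (AlgPoints.map (emb ι a) (AlgPoints.map (fiberι (proj ι a) t) y)),
        e1, e2]
    rw [← hQ]
    exact AlgPoints.pt_map_mem_range (emb ι a) _
  · intro h
    set Q := AlgPoints.liftClosed (emb ι a) (CartesianMonoidalCategory.lift x t) h with hQdef
    have hQ : AlgPoints.map (emb ι a) Q = CartesianMonoidalCategory.lift x t :=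
      AlgPoints.map_liftClosed _ _ h
    have hπ : AlgPoints.map (proj ι a) Q = t := by
      rw [← emb_snd, AlgPoints.map_comp_apply, hQ, AlgPoints.map_apply,
        CartesianMonoidalCategory.lift_snd]
    have hQmem : Q ∈ Set.range (AlgPoints.map (fiberι (proj ι a) t)) := by
      rw [AlgPoints.range_map_fiberι]
      exact hπ
    obtain ⟨y, hy⟩ := hQmem
    refine ⟨y, ?_⟩
    rw [AlgPoints.map_comp_apply, hy, ← emb_fst, AlgPoints.map_comp_apply, hQ, AlgPoints.map_apply,
      CartesianMonoidalCategory.lift_fst]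

/-! ### Weak Lefschetz for the smooth members through the blow-down -/

/-- **Injectivity**: for `X` smooth projective of dimension `r + 1`, a complex point `t` of `ℙ¹`
whose fibre `π⁻¹(t)` is smooth projective, and `k ≤ r`, the composite `u_t : π⁻¹(t) ⟶ X̃ ⟶ X`
induces an injection `Hᵏ(X(ℂ); ℂ) → Hᵏ(π⁻¹(t)(ℂ); ℂ)` — Andreotti–Frankel for
`X(ℂ) ∖ u_t(π⁻¹(t)(ℂ)) = X(ℂ) ∖ (X ∩ H_t)(ℂ)` (`range_map_fiberι_blowDown`) and the injective duality
step. [cite: VoisinHodgeII2003, §1.2.2 Thm. 1.22–1.23] -/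
theorem injective_complexBettiMap_fiberι_blowDown {r n' : ℕ} (hX : IsSmoothProjective (r + 1) X)
    (t : ComplexPoints (projectiveSpace 1 ℂ)) (hY : IsSmoothProjective n' (fiberOver (proj ι a) t))
    {k : ℕ} (hk : k ≤ r) :
    Function.Injective (complexBetti.map (fiberι (proj ι a) t ≫ blowDown ι a) k) := by
  obtain ⟨w, hw, rfl⟩ := ProjectiveSpace.exists_eq_pointOfVec t
  haveI := isClosedImmersion_fiberι_blowDown_left ι a (ProjectiveSpace.pointOfVec ℂ w hw)
  have hAF := HypersurfaceSectionComplement.isZero_singularHomology_compl_range_hypersurfaceSectionι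
    (R := ℂ) (M₀ := ℂ) hX ⟨N, ι, inferInstance⟩ le_rfl (Resolution.LinSec.linForm (fun c ↦ w 1 * a 0 c - w 0 * a 1 c))
    (isHomogeneous_linForm_member a w) (j := 2 * (r + 1) - k) (by omega)
  rw [← range_map_fiberι_blowDown ι a w hw] at hAF
  exact injective_complexBettiMap_of_isZero_singularHomology_compl_range hX hY
    (fiberι (proj ι a) _ ≫ blowDown ι a) (j := 2 * (r + 1) - k) (by omega) hAF

/-- **Bijectivity below the dimension of the fibre**: with `X`, `t` as above and `k < r`, the map
`Hᵏ(X(ℂ); ℂ) → Hᵏ(π⁻¹(t)(ℂ); ℂ)` induced by `u_t` is bijective (the surjective duality step as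
well). [cite: VoisinHodgeII2003, §1.2.2 Thm. 1.22–1.23] -/
theorem bijective_complexBettiMap_fiberι_blowDown_of_lt {r n' : ℕ} (hX : IsSmoothProjective (r + 1) X)
    (t : ComplexPoints (projectiveSpace 1 ℂ)) (hY : IsSmoothProjective n' (fiberOver (proj ι a) t))
    {k : ℕ} (hk : k < r) :
    Function.Bijective (complexBetti.map (fiberι (proj ι a) t ≫ blowDown ι a) k) := by
  refine ⟨injective_complexBettiMap_fiberι_blowDown ι a hX t hY hk.le, ?_⟩
  obtain ⟨w, hw, rfl⟩ := ProjectiveSpace.exists_eq_pointOfVec t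
  haveI := isClosedImmersion_fiberι_blowDown_left ι a (ProjectiveSpace.pointOfVec ℂ w hw)
  have hAF := HypersurfaceSectionComplement.isZero_singularHomology_compl_range_hypersurfaceSectionι
    (R := ℂ) (M₀ := ℂ) hX ⟨N, ι, inferInstance⟩ le_rfl (Resolution.LinSec.linForm (fun c ↦ w 1 * a 0 c - w 0 * a 1 c))
    (isHomogeneous_linForm_member a w) (j := 2 * (r + 1) - 1 - k) (by omega)
  rw [← range_map_fiberι_blowDown ι a w hw] at hAF
  exact surjective_complexBettiMap_of_isZero_singularHomology_compl_range hX hY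
    (fiberι (proj ι a) _ ≫ blowDown ι a) (j := 2 * (r + 1) - 1 - k) (by omega) hAF

end Pencil

end HodgeTheory

end Literature.AlgebraicGeometry.HodgeTheory

end
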